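import Literature.NumberTheory.Automorphic.AdelicBoxCount
import Literature.NumberTheory.Automorphic.AdelicUnitaryGroup
import Mathlib.NumberTheory.NumberField.InfinitePlace.TotallyRealComplex
import HarnessLib

/-!
# Counting principal HERMITIAN matrices in a positive real diagonal box `diag(a) · B · diag(a)`
(Borel, *Introduction aux groupes arithmétiques* (1969), §1, §8 — lattice points in dilated boxes; Cassels–Fröhlich,
Ch. II §14 — `K` discrete in `𝔸_K`; the count behind Borel–Harish-Chandra finiteness for a unitary group
`U(H) ≤ Res_{L/L⁺} GL_N` by orbit-count unfolding against the reduction theory of `GL_N` over the CM field `L`)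

Topic `NumberTheory/Automorphic`; namespace `Literature.NumberTheory.Automorphic`.  THEOREMS ONLY (no definition, no
named fact, no `sorry`).  Companion of ★ `AdelicBoxCount` (`ncard_algebraMap_mem_realAdele_smul_le`: the rational points
`k ∈ K` with `k ∈ (r, 1) · B` number `≤ C_B · max(1, r)^{[K:ℚ]}`; `ncard_rationalPointsGL_conj_posRealDiagonal_le`).

For a CM field `L` (complex conjugation `x ↦ x̄ = cmConjRingHom L x`, maximal totally real subfield `L⁺`, `[L:ℚ] = d_L`,
`[L⁺:ℚ] = d_L / 2`):

* §1 `NumberField.ncard_integers_real_mixedEmbedding_mem_smul_le` (any number field `K`): the algebraic integers `x` which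
  are REAL at every complex place (`Im σ_w(x) = 0`) and lie in `r · B` (`B ⊆ K ⊗ ℝ` bounded) number `≤ C_B · max(1, r)^{r₁ + r₂}`
  — packing (★ `ncard_inter_closedBall_le_of_le_dist`) in the REAL-PART space `ℝ^{r₁} × ℝ^{r₂}` (dimension `r₁ + r₂`, not
  `r₁ + 2 r₂ = [K:ℚ]`), to which the discrete `integerLattice` restricted to the real points maps isometrically;
* §2 the CM forms: `x̄ = x ⇒` real at every complex place (★ `embedding_cmConjRingHom`), `r₁ + r₂ = d_L / 2` (`L` totally
  complex), so **`NumberField.ncard_integers_cmConjFixed_mixedEmbedding_mem_smul_le`** — conjugation-fixed integers in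
  `r · B` number `≤ C_B · max(1, r)^{d_L/2}`; and the adelic form **`ncard_cmConjFixed_algebraMap_mem_realAdele_smul_le`**:
  for compact `B ⊆ 𝔸_L`, `#{k ∈ L : k̄ = k, k ∈ (r, 1) · B} ≤ C_B · max(1, r)^{d_L/2}` (denominators cleared by a
  conjugation-FIXED integer `d d̄`, then §1);
* §3 **`ncard_hermitian_principal_box_le`**: for compact `B ⊆ M_N(𝔸_L)` there is `C > 0` such that for every positive
  real diagonal `a = diag(a₁, …, a_N)` (★ `posRealDiagonal`, archimedean components only) the principal HERMITIAN matrices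
  `h ∈ M_N(L)`, `ᵗh̄ = h`, with `diag(a) · h · diag(a) ∈ B` are finite in number, at most
  `C · ∏_{i<j} max(1, (a_i a_j)⁻¹)^{d_L} · ∏_i max(1, a_i⁻²)^{d_L/2}`: the `(i, j)` entry of `diag(a) h diag(a)` is
  `(a_i a_j, 1) · h_{ij}` (`coe_posRealDiagonal_mul_mul_posRealDiagonal_apply`), the entries above the diagonal are free
  in `L` (★ count, exponent `d_L`), the diagonal entries are conjugation-fixed (§2, exponent `d_L / 2`), and the entries
  below the diagonal are determined (`h_{ji} = h̄_{ij}`).  The halved exponent on the diagonal is what makes the count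
  integrable against the modulus of the Borel subgroup on a Siegel set of `GL_N(𝔸_L)` (consumer: the finite covolume of
  `U(H)(L⁺)` in `U(H)(𝔸_{L⁺})` for a hermitian `H ∈ GL_N(L)`, cell hodgecm-mathlib, S3 of the line
  `F0_T1InnerFormTraceIdentity`, file plan `FILEPLAN-S3-OrbitCountUnfolding` T2).

## References
* A. Borel, *Introduction aux groupes arithmétiques*, Hermann (1969), §1 (lattice points in boxes), §8 [Borel1969].
* J. W. S. Cassels, A. Fröhlich (eds.), *Algebraic Number Theory* (1967), Ch. II §14 (`K` discrete in `𝔸_K`)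
  [CasselsFrohlichANT1967].
* A. Borel, *Some finiteness properties of adele groups over number fields*, Publ. Math. IHÉS 16 (1963), §5 [Borel1963].
-/

noncomputable section

open scoped NNReal Matrix MatrixGroups Pointwise Classical
open NumberField NumberField.InfinitePlace NumberField.mixedEmbedding IsDedekindDomain Set Metric Module
open _root_.Topology

namespace Literature.NumberTheory.Automorphic

/-! ## §1 Integers real at every complex place, in real dilates of a bounded subset of `K ⊗ ℝ` -/

section RealIntegers

variable (K : Type) [Field K] [NumberField K]

/-- **Integers of `K` that are real at every complex place, in real dilates of a bounded set.**  For a bounded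
`B ⊆ ℝ^{r₁} × ℂ^{r₂}` there is `C > 0` such that for every `r > 0` the algebraic integers `x` with `Im σ_w(x) = 0` at every
complex place `w` and `ι(x) ∈ r · B` (`ι = mixedEmbedding K`) are finite in number, at most `C · max(1, r)^{r₁ + r₂}`: the
real-part map `(y, z) ↦ (y, Re z)` to `ℝ^{r₁} × ℝ^{r₂}` is norm-non-increasing and ISOMETRIC on the points real at every
complex place, so it carries the discrete `ι(𝓞 K)` restricted to those points to an `ε`-separated set, to which the packing
bound (★ `ncard_inter_closedBall_le_of_le_dist`) applies in dimension `r₁ + r₂`.  Borel (1969), §1.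
[cite: Borel1969, §1] [cite: CasselsFrohlichANT1967, Ch. II §14] -/
theorem NumberField.ncard_integers_real_mixedEmbedding_mem_smul_le {B : Set (mixedSpace K)}
    (hB : Bornology.IsBounded B) :
    ∃ C : ℝ, 0 < C ∧ ∀ r : ℝ, 0 < r →
      {x : 𝓞 K | (∀ w : {w : InfinitePlace K // IsComplex w}, ((mixedEmbedding K (x : K)).2 w).im = 0) ∧
          mixedEmbedding K (x : K) ∈ r • B}.Finite ∧
        (({x : 𝓞 K | (∀ w : {w : InfinitePlace K // IsComplex w}, ((mixedEmbedding K (x : K)).2 w).im = 0) ∧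
            mixedEmbedding K (x : K) ∈ r • B}.ncard : ℕ) : ℝ) ≤
          C * max 1 r ^ (nrRealPlaces K + nrComplexPlaces K) := by
  obtain ⟨R₀, hR₀, hBR⟩ := hB.subset_closedBall_lt 0 (0 : mixedSpace K)
  obtain ⟨ε, hε, hsep⟩ :=
    Submodule.exists_pos_forall_le_dist_of_discrete (mixedEmbedding.integerLattice K)
  refine ⟨(2 * R₀ / ε + 1) ^ (nrRealPlaces K + nrComplexPlaces K), by positivity, fun r hr => ?_⟩
  -- the real-part map `Φ : ℝ^{r₁} × ℂ^{r₂} → ℝ^{r₁} × ℝ^{r₂}`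
  set Φ : mixedSpace K →
      ({w : InfinitePlace K // IsReal w} → ℝ) × ({w : InfinitePlace K // IsComplex w} → ℝ) :=
    fun z => (z.1, fun w => (z.2 w).re) with hΦ
  have hΦsub : ∀ z z' : mixedSpace K, Φ z - Φ z' = Φ (z - z') := fun z z' =>
    Prod.ext rfl (funext fun w => (Complex.sub_re _ _).symm)
  -- `Φ` does not increase norms …
  have hΦle : ∀ z : mixedSpace K, ‖Φ z‖ ≤ ‖z‖ := by
    intro z
    rw [Prod.norm_def, Prod.norm_def]
    refine max_le_max le_rfl ((pi_norm_le_iff_of_nonneg (norm_nonneg _)).2 fun w => ?_)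
    calc ‖(z.2 w).re‖ = |(z.2 w).re| := Real.norm_eq_abs _
      _ ≤ ‖z.2 w‖ := Complex.abs_re_le_norm _
      _ ≤ ‖z.2‖ := norm_le_pi_norm _ w
  -- … and preserves them on the points real at every complex place
  have hΦge : ∀ z : mixedSpace K, (∀ w, (z.2 w).im = 0) → ‖z‖ ≤ ‖Φ z‖ := by
    intro z hz
    rw [Prod.norm_def, Prod.norm_def]
    refine max_le_max le_rfl ((pi_norm_le_iff_of_nonneg (norm_nonneg _)).2 fun w => ?_)
    calc ‖z.2 w‖ = |(z.2 w).re| := (Complex.abs_re_eq_norm.2 (hz w)).symm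
      _ = ‖(Φ z).2 w‖ := (Real.norm_eq_abs _).symm
      _ ≤ ‖(Φ z).2‖ := norm_le_pi_norm _ w
  -- the lattice, its real points, and their image `T` under `Φ`
  set Λ : Set (mixedSpace K) := (mixedEmbedding.integerLattice K : Set (mixedSpace K)) with hΛ
  set V : Set (mixedSpace K) := {z | ∀ w, (z.2 w).im = 0} with hV
  have hVsub : ∀ z ∈ V, ∀ z' ∈ V, z - z' ∈ V := fun z hz z' hz' w => by
    rw [Prod.snd_sub, Pi.sub_apply, Complex.sub_im, hz w, hz' w, sub_zero]
  set T : Set (({w : InfinitePlace K // IsReal w} → ℝ) × ({w : InfinitePlace K // IsComplex w} → ℝ)) :=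
    Φ '' (Λ ∩ V) with hT
  have hTsep : ∀ t ∈ T, ∀ t' ∈ T, t ≠ t' → ε ≤ dist t t' := by
    rintro t ⟨z, ⟨hzΛ, hzV⟩, rfl⟩ t' ⟨z', ⟨hz'Λ, hz'V⟩, rfl⟩ htt'
    have hzz' : z ≠ z' := fun h => htt' (by rw [h])
    calc ε ≤ dist z z' := hsep z hzΛ z' hz'Λ hzz'
      _ = ‖z - z'‖ := dist_eq_norm _ _
      _ ≤ ‖Φ (z - z')‖ := hΦge _ (hVsub z hzV z' hz'V)
      _ = dist (Φ z) (Φ z') := by rw [dist_eq_norm, hΦsub]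
  have hpack := ncard_inter_closedBall_le_of_le_dist (Λ := T) hε hTsep (R := r * R₀) (by positivity)
  -- `x ↦ Φ (ι x)` maps our set injectively into `T ∩ B̄(0, r R₀)`
  set S : Set (𝓞 K) := {x : 𝓞 K |
    (∀ w : {w : InfinitePlace K // IsComplex w}, ((mixedEmbedding K (x : K)).2 w).im = 0) ∧
      mixedEmbedding K (x : K) ∈ r • B} with hS
  have hnorm : ∀ x ∈ S, ‖mixedEmbedding K (x : K)‖ ≤ r * R₀ := by
    intro x hx
    obtain ⟨b, hb, hbx⟩ := Set.mem_smul_set.1 hx.2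
    rw [← hbx, _root_.norm_smul, Real.norm_eq_abs, abs_of_pos hr]
    have := hBR hb
    rw [mem_closedBall, dist_zero_right] at this
    exact mul_le_mul_of_nonneg_left this hr.le
  have hmaps : ∀ x ∈ S, Φ (mixedEmbedding K (x : K)) ∈ T ∩ closedBall 0 (r * R₀) := by
    intro x hx
    refine ⟨⟨mixedEmbedding K (x : K), ⟨⟨x, rfl⟩, hx.1⟩, rfl⟩, ?_⟩
    rw [mem_closedBall, dist_zero_right]
    exact (hΦle _).trans (hnorm x hx)
  have hinj : Set.InjOn (fun x : 𝓞 K => Φ (mixedEmbedding K (x : K))) S := by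
    intro x hx y hy hxy
    have h0 : ‖mixedEmbedding K (x : K) - mixedEmbedding K (y : K)‖ ≤ 0 := by
      calc ‖mixedEmbedding K (x : K) - mixedEmbedding K (y : K)‖
          ≤ ‖Φ (mixedEmbedding K (x : K) - mixedEmbedding K (y : K))‖ := hΦge _ (hVsub _ hx.1 _ hy.1)
        _ = ‖Φ (mixedEmbedding K (x : K)) - Φ (mixedEmbedding K (y : K))‖ := by rw [hΦsub]
        _ = 0 := by rw [show Φ (mixedEmbedding K (x : K)) = Φ (mixedEmbedding K (y : K)) from hxy, sub_self,
            norm_zero]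
    have h1 : mixedEmbedding K (x : K) = mixedEmbedding K (y : K) :=
      sub_eq_zero.1 (norm_le_zero_iff.1 h0)
    exact RingOfIntegers.ext ((mixedEmbedding_injective K) h1)
  have hle : S.ncard ≤ (T ∩ closedBall 0 (r * R₀)).ncard := Set.ncard_le_ncard_of_injOn _ hmaps hinj hpack.1
  have hSfin : S.Finite :=
    Set.Finite.of_finite_image (hpack.1.subset (Set.image_subset_iff.2 hmaps)) hinj
  refine ⟨hSfin, ?_⟩
  have hD : finrank ℝ (({w : InfinitePlace K // IsReal w} → ℝ) × ({w : InfinitePlace K // IsComplex w} → ℝ)) =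
      nrRealPlaces K + nrComplexPlaces K := by
    rw [finrank_prod, finrank_pi ℝ, finrank_pi ℝ]
  calc ((S.ncard : ℕ) : ℝ) ≤ (T ∩ closedBall 0 (r * R₀)).ncard := by exact_mod_cast hle
    _ ≤ (2 * (r * R₀) / ε + 1) ^
          finrank ℝ (({w : InfinitePlace K // IsReal w} → ℝ) × ({w : InfinitePlace K // IsComplex w} → ℝ)) :=
        hpack.2
    _ ≤ ((2 * R₀ / ε + 1) * max 1 r) ^
          finrank ℝ (({w : InfinitePlace K // IsReal w} → ℝ) × ({w : InfinitePlace K // IsComplex w} → ℝ)) := by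
        refine pow_le_pow_left₀ (by positivity) ?_ _
        have h1 : (1 : ℝ) ≤ max 1 r := le_max_left _ _
        have h2 : r ≤ max 1 r := le_max_right _ _
        have h3 : 0 ≤ 2 * R₀ / ε := by positivity
        calc 2 * (r * R₀) / ε + 1 = 2 * R₀ / ε * r + 1 := by ring
          _ ≤ 2 * R₀ / ε * max 1 r + max 1 r := add_le_add (mul_le_mul_of_nonneg_left h2 h3) h1
          _ = (2 * R₀ / ε + 1) * max 1 r := by ring
    _ = (2 * R₀ / ε + 1) ^ (nrRealPlaces K + nrComplexPlaces K) *
          max 1 r ^ (nrRealPlaces K + nrComplexPlaces K) := by rw [mul_pow, hD]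

end RealIntegers

/-! ## §2 CM fields: conjugation-fixed points -/

section CM

variable (L : Type) [Field L] [NumberField L] [IsCMField L]

/-- A conjugation-fixed element of a CM field is real at every complex place: `x̄ = x ⇒ Im σ_w(x) = 0` (every complex
embedding intertwines `x ↦ x̄` with complex conjugation, ★ `embedding_cmConjRingHom`). [cite: CasselsFrohlichANT1967, Ch. II §14] -/
theorem im_mixedEmbedding_eq_zero_of_cmConjRingHom_eq {x : L} (hx : cmConjRingHom L x = x)
    (w : {w : InfinitePlace L // IsComplex w}) : ((mixedEmbedding L x).2 w).im = 0 := by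
  rw [mixedEmbedding_apply_isComplex, ← Complex.conj_eq_iff_im, ← embedding_cmConjRingHom, hx]

/-- For a CM field `r₁ + r₂ = [L:ℚ] / 2` (`L` is totally complex: `r₁ = 0`, `[L:ℚ] = 2 r₂`). [cite: CasselsFrohlichANT1967, Ch. II §14] -/
theorem nrRealPlaces_add_nrComplexPlaces_eq_finrank_div_two :
    nrRealPlaces L + nrComplexPlaces L = finrank ℚ L / 2 := by
  rw [IsTotallyComplex.nrRealPlaces_eq_zero, IsTotallyComplex.finrank, zero_add,
    Nat.mul_div_cancel_left _ Nat.two_pos]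

/-- **Conjugation-fixed integers of a CM field in real dilates of a bounded set.**  For a bounded `B ⊆ L ⊗ ℝ` there is
`C > 0` such that for every `r > 0` the algebraic integers `x` with `x̄ = x` and `ι(x) ∈ r · B` are finite in number, at
most `C · max(1, r)^{[L:ℚ]/2}` (they are real at every complex place, §1, and `r₁ + r₂ = [L:ℚ]/2`; equivalently: they are
the integers of `L⁺`, a field of degree `[L:ℚ]/2`). [cite: Borel1969, §1] [cite: CasselsFrohlichANT1967, Ch. II §14] -/
theorem NumberField.ncard_integers_cmConjFixed_mixedEmbedding_mem_smul_le {B : Set (mixedSpace L)}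
    (hB : Bornology.IsBounded B) :
    ∃ C : ℝ, 0 < C ∧ ∀ r : ℝ, 0 < r →
      {x : 𝓞 L | cmConjRingHom L (x : L) = x ∧ mixedEmbedding L (x : L) ∈ r • B}.Finite ∧
        (({x : 𝓞 L | cmConjRingHom L (x : L) = x ∧ mixedEmbedding L (x : L) ∈ r • B}.ncard : ℕ) : ℝ) ≤
          C * max 1 r ^ (finrank ℚ L / 2) := by
  obtain ⟨C, hC, h⟩ := NumberField.ncard_integers_real_mixedEmbedding_mem_smul_le L hB
  refine ⟨C, hC, fun r hr => ?_⟩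
  obtain ⟨hfin, hle⟩ := h r hr
  have hsub : {x : 𝓞 L | cmConjRingHom L (x : L) = x ∧ mixedEmbedding L (x : L) ∈ r • B} ⊆
      {x : 𝓞 L | (∀ w : {w : InfinitePlace L // IsComplex w}, ((mixedEmbedding L (x : L)).2 w).im = 0) ∧
        mixedEmbedding L (x : L) ∈ r • B} :=
    fun x hx => ⟨fun w => im_mixedEmbedding_eq_zero_of_cmConjRingHom_eq L hx.1 w, hx.2⟩
  refine ⟨hfin.subset hsub, ?_⟩
  rw [← nrRealPlaces_add_nrComplexPlaces_eq_finrank_div_two]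
  exact (Nat.cast_le.2 (Set.ncard_le_ncard hsub hfin)).trans hle

/-- **Conjugation-fixed rational points in real dilates of a compact adelic box.**  For compact `B ⊆ 𝔸_L` there is
`C > 0` such that for every `r > 0` the field elements `k ∈ L` with `k̄ = k` whose adele lies in `(r, 1) · B` (`realAdele L r`:
the real scalar `r` at the archimedean places, `1` at the finite ones) are finite in number, at most
`C · max(1, r)^{[L:ℚ]/2}`.  Proof: as for ★ `ncard_algebraMap_mem_realAdele_smul_le`, clearing the denominators of the
finite parts of `B` by a CONJUGATION-FIXED non-zero integer `d d̄` (`d` from ★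
`FiniteAdeleRing.exists_ne_zero_forall_mem_mul_mem`), so that `d d̄ k ∈ 𝓞 L` is again conjugation-fixed, and counting
with `NumberField.ncard_integers_cmConjFixed_mixedEmbedding_mem_smul_le`.  This is the quantitative discreteness of `L⁺`
in `𝔸_L` along the archimedean dilations. [cite: CasselsFrohlichANT1967, Ch. II §14] [cite: Borel1969, §1] -/
theorem ncard_cmConjFixed_algebraMap_mem_realAdele_smul_le {B : Set (AdeleRing (𝓞 L) L)} (hB : IsCompact B) :
    ∃ C : ℝ, 0 < C ∧ ∀ r : ℝ, 0 < r →
      {k : L | cmConjRingHom L k = k ∧ algebraMap L (AdeleRing (𝓞 L) L) k ∈ realAdele L r • B}.Finite ∧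
        (({k : L | cmConjRingHom L k = k ∧ algebraMap L (AdeleRing (𝓞 L) L) k ∈ realAdele L r • B}.ncard : ℕ) :
            ℝ) ≤ C * max 1 r ^ (finrank ℚ L / 2) := by
  -- clear denominators of the finite parts by a conjugation-fixed integer `d = d₀ d̄₀`
  have hBf : IsCompact (Prod.snd '' B) := hB.image continuous_snd
  obtain ⟨d₀, hd₀, hd₀B⟩ := FiniteAdeleRing.exists_ne_zero_forall_mem_mul_mem L hBf
  set d : 𝓞 L := d₀ * RingOfIntegers.mapRingHom (cmConjRingHom L) d₀ with hd_def
  have hdconj : cmConjRingHom L (d : L) = d := by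
    rw [hd_def, RingOfIntegers.coe_eq_algebraMap, map_mul, map_mul, ← RingOfIntegers.coe_eq_algebraMap,
      ← RingOfIntegers.coe_eq_algebraMap, RingOfIntegers.mapRingHom_apply, cmConjRingHom_apply, cmConjRingHom_apply,
      IsCMField.complexConj_apply_apply, mul_comm]
  have hd0 : d ≠ 0 := by
    refine mul_ne_zero hd₀ fun h => hd₀ ?_
    have h' : cmConjRingHom L (d₀ : L) = 0 := by
      rw [← RingOfIntegers.mapRingHom_apply, h]; rfl
    have h'' : (d₀ : L) = 0 := by
      have := congrArg (cmConjRingHom L) h'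
      rwa [cmConjRingHom_apply, cmConjRingHom_apply, IsCMField.complexConj_apply_apply, map_zero] at this
    exact RingOfIntegers.ext (by simpa using h'')
  have hd : ∀ a ∈ Prod.snd '' B, ∀ v : HeightOneSpectrum (𝓞 L),
      (algebraMap (𝓞 L) (FiniteAdeleRing (𝓞 L) L) d * a) v ∈ v.adicCompletionIntegers L := by
    intro a ha v
    rw [hd_def, mul_comm d₀, map_mul, mul_assoc]
    exact mul_mem (algebraMap_mem_adicCompletionIntegers (𝓞 L) L v _) (hd₀B a ha v)
  -- the archimedean parts, in the mixed space, multiplied by `ι(d)`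
  set B' : Set (mixedSpace L) :=
    (fun y => mixedEmbedding L (d : L) * y) ''
      (InfiniteAdeleRing.ringEquiv_mixedSpace L '' (Prod.fst '' B)) with hB'
  have hB'c : IsCompact B' :=
    (((hB.image continuous_fst).image (continuous_ringEquiv_mixedSpace L)).image
      (continuous_const.mul continuous_id))
  obtain ⟨C, hC, hcount⟩ := NumberField.ncard_integers_cmConjFixed_mixedEmbedding_mem_smul_le L hB'c.isBounded
  refine ⟨C, hC, fun r hr => ?_⟩
  set S : Set L := {k : L | cmConjRingHom L k = k ∧ algebraMap L (AdeleRing (𝓞 L) L) k ∈ realAdele L r • B} with hS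
  set T : Set (𝓞 L) := {x : 𝓞 L | cmConjRingHom L (x : L) = x ∧ mixedEmbedding L (x : L) ∈ r • B'} with hT
  obtain ⟨hTfin, hTle⟩ := hcount r hr
  -- `k ↦ d k` lands in `𝓞 L`, inside `T`
  have hint : ∀ k ∈ S, ∃ x : 𝓞 L, (x : L) = d * k := by
    intro k hk
    obtain ⟨b, hb, hbk⟩ := Set.mem_smul_set.1 hk.2
    rw [← isFiniteIntegral_algebraMap_iff]
    intro v
    rw [map_mul, ← hbk, smul_eq_mul]
    change ((algebraMap L (AdeleRing (𝓞 L) L) (d : L)).2 * ((realAdele L r).2 * b.2)) v ∈ _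
    rw [realAdele_snd, one_mul, AdeleRing.algebraMap_snd]
    have e : algebraMap L (FiniteAdeleRing (𝓞 L) L) (d : L) =
        algebraMap (𝓞 L) (FiniteAdeleRing (𝓞 L) L) d := by
      rw [← IsScalarTower.algebraMap_apply]
    rw [e]
    exact hd b.2 ⟨b, hb, rfl⟩ v
  choose! f hf using hint
  have hmaps : ∀ k ∈ S, f k ∈ T := by
    intro k hk
    obtain ⟨b, hb, hbk⟩ := Set.mem_smul_set.1 hk.2
    refine ⟨?_, ?_⟩
    · rw [hf k hk, map_mul, hdconj, hk.1]
    · rw [hf k hk, map_mul, InfiniteAdeleRing.mixedEmbedding_eq_algebraMap_comp (x := k),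
        ← AdeleRing.algebraMap_fst, ← hbk, smul_eq_mul]
      change mixedEmbedding L (d : L) *
          InfiniteAdeleRing.ringEquiv_mixedSpace L ((realAdele L r).1 * b.1) ∈ r • B'
      rw [realAdele_fst, map_mul, ringEquiv_mixedSpace_realToInfiniteAdele, ← Algebra.smul_def,
        mul_smul_comm]
      exact Set.smul_mem_smul_set ⟨_, ⟨b.1, ⟨b, hb, rfl⟩, rfl⟩, rfl⟩
  have hinj : Set.InjOn f S := by
    intro k hk k' hk' hkk'
    have h1 := hf k hk
    have h2 := hf k' hk'
    rw [hkk'] at h1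
    have hd0' : ((d : 𝓞 L) : L) ≠ 0 := by exact_mod_cast hd0
    exact mul_left_cancel₀ hd0' (h1.symm.trans h2)
  have hle : S.ncard ≤ T.ncard := Set.ncard_le_ncard_of_injOn f hmaps hinj hTfin
  have hSfin : S.Finite :=
    Set.Finite.of_finite_image (hTfin.subset (Set.image_subset_iff.2 hmaps)) hinj
  exact ⟨hSfin, (Nat.cast_le.2 hle).trans hTle⟩

end CM

/-! ## §3 Principal hermitian matrices in `diag(a) · B · diag(a)` -/

section Matrices

variable {n : ℕ} {K : Type} [Field K] [NumberField K]

/-- **Entries of `a M a`.**  For a positive real diagonal `a = diag(a₁, …, aₙ)` (★ `posRealDiagonal`) and any adelic matrix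
`M`, the `(i, j)` entry of `a M a` is `(a_i a_j, 1) · M_{ij}` — the real scalar `a_i a_j` acting on the archimedean components
only (companion of ★ `coe_posRealDiagonal_mul_mul_inv_apply`). [cite: Borel1969, §8] -/
theorem coe_posRealDiagonal_mul_mul_posRealDiagonal_apply (a : Fin n → ℝ≥0ˣ)
    (M : Matrix (Fin n) (Fin n) (AdeleRing (𝓞 K) K)) (i j : Fin n) :
    ((posRealDiagonal n K a : Matrix (Fin n) (Fin n) (AdeleRing (𝓞 K) K)) * M *
        (posRealDiagonal n K a : Matrix (Fin n) (Fin n) (AdeleRing (𝓞 K) K))) i j =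
      realAdele K (((a i : ℝ≥0) : ℝ) * ((a j : ℝ≥0) : ℝ)) * M i j := by
  rw [coe_posRealDiagonal, Matrix.mul_diagonal, Matrix.diagonal_mul, coe_posRealIdele, coe_posRealIdele,
    realAdele_mul]
  ring

variable (L : Type) [Field L] [NumberField L] [IsCMField L] (N : ℕ)

/-- **Principal hermitian matrices in a positive real diagonal box.**  For compact `B ⊆ M_N(𝔸_L)` (`L` a CM field) there
is `C > 0` such that for every positive real diagonal `a = diag(a₁, …, a_N)` (★ `posRealDiagonal`) the hermitian matrices
`h ∈ M_N(L)` (`ᵗh̄ = h`) with `diag(a) · h · diag(a) ∈ B` are finite in number, at most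
`C · ∏_{i<j} max(1, (a_i a_j)⁻¹)^{[L:ℚ]} · ∏_i max(1, a_i⁻²)^{[L:ℚ]/2}`: the `(i, j)` entry of `diag(a) h diag(a)` is the
principal adele `(a_i a_j, 1) · h_{ij}` lying in the compact set of `(i, j)` entries of `B`, so `h_{ij} ∈ ((a_i a_j)⁻¹, 1) · B_{ij}`;
above the diagonal there are at most `C_{ij} max(1, (a_i a_j)⁻¹)^{[L:ℚ]}` such `h_{ij} ∈ L` (★
`ncard_algebraMap_mem_realAdele_smul_le`), on the diagonal `h_{ii}` is conjugation-fixed and there are at most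
`C_i max(1, a_i⁻²)^{[L:ℚ]/2}` of them (`ncard_cmConjFixed_algebraMap_mem_realAdele_smul_le`), and below the diagonal
`h_{ji} = h̄_{ij}` is determined.  (Borel (1969), §8: the number of lattice points of a fixed rational structure in
`a · B · a` on a Siegel set; here for the hermitian matrices `ᵗγ̄ H γ`, `γ ∈ GL_N(L)`, met by the orbit-count proof of the
finite covolume of `U(H)(L⁺)`.) [cite: Borel1969, §8] [cite: Borel1963, §5] -/
theorem ncard_hermitian_principal_box_le {B : Set (Matrix (Fin N) (Fin N) (AdeleRing (𝓞 L) L))} (hB : IsCompact B) :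
    ∃ C : ℝ, 0 < C ∧ ∀ a : Fin N → ℝ≥0ˣ,
      {h : Matrix (Fin N) (Fin N) L | (h.map (cmConjRingHom L))ᵀ = h ∧
          (posRealDiagonal N L a : Matrix (Fin N) (Fin N) (AdeleRing (𝓞 L) L)) *
              h.map (algebraMap L (AdeleRing (𝓞 L) L)) *
            (posRealDiagonal N L a : Matrix (Fin N) (Fin N) (AdeleRing (𝓞 L) L)) ∈ B}.Finite ∧
      (({h : Matrix (Fin N) (Fin N) L | (h.map (cmConjRingHom L))ᵀ = h ∧
          (posRealDiagonal N L a : Matrix (Fin N) (Fin N) (AdeleRing (𝓞 L) L)) *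
              h.map (algebraMap L (AdeleRing (𝓞 L) L)) *
            (posRealDiagonal N L a : Matrix (Fin N) (Fin N) (AdeleRing (𝓞 L) L)) ∈ B}.ncard : ℕ) : ℝ) ≤
        C * (∏ i : Fin N, ∏ j : Fin N,
              if i < j then max 1 ((((a i : ℝ≥0) : ℝ) * ((a j : ℝ≥0) : ℝ))⁻¹) ^ finrank ℚ L else 1) *
          ∏ i : Fin N, max 1 ((((a i : ℝ≥0) : ℝ) ^ 2)⁻¹) ^ (finrank ℚ L / 2) := by
  -- the compact sets of entries
  set E : Fin N → Fin N → Set (AdeleRing (𝓞 L) L) := fun i j =>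
    (fun M : Matrix (Fin N) (Fin N) (AdeleRing (𝓞 L) L) => M i j) '' B with hE
  have hEc : ∀ i j, IsCompact (E i j) := fun i j => hB.image (Continuous.matrix_elem continuous_id i j)
  -- the counting constants: off-diagonal (★) and diagonal (conjugation-fixed)
  choose Cij hCij hcnt using fun i j => ncard_algebraMap_mem_realAdele_smul_le L (hEc i j)
  choose Ci hCi hcnt' using fun i => ncard_cmConjFixed_algebraMap_mem_realAdele_smul_le L (hEc i i)
  refine ⟨(∏ i, ∏ j, if i < j then Cij i j else 1) * ∏ i, Ci i,
    mul_pos (Finset.prod_pos fun i _ => Finset.prod_pos fun j _ => by split_ifs; exacts [hCij i j, one_pos])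
      (Finset.prod_pos fun i _ => hCi i), fun a => ?_⟩
  have hapos : ∀ i, 0 < ((a i : ℝ≥0) : ℝ) := fun i => NNReal.coe_pos.2 (pos_iff_ne_zero.2 (a i).ne_zero)
  -- the dilation factors
  set r : Fin N → Fin N → ℝ := fun i j => (((a i : ℝ≥0) : ℝ) * ((a j : ℝ≥0) : ℝ))⁻¹ with hr
  have hrpos : ∀ i j, 0 < r i j := fun i j => inv_pos.2 (mul_pos (hapos i) (hapos j))
  -- the finite sets of admissible entries: free above the diagonal, conjugation-fixed on it, `0` below
  set T : Fin N → Fin N → Set L := fun i j =>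
    if i < j then {k : L | algebraMap L (AdeleRing (𝓞 L) L) k ∈ realAdele L (r i j) • E i j}
    else if i = j then {k : L | cmConjRingHom L k = k ∧ algebraMap L (AdeleRing (𝓞 L) L) k ∈ realAdele L (r i j) • E i j}
    else {0} with hT
  have hTfin : ∀ i j, (T i j).Finite := by
    intro i j
    by_cases h1 : i < j
    · simp only [hT, if_pos h1]
      exact (hcnt i j (r i j) (hrpos i j)).1
    · by_cases h2 : i = j
      · subst h2
        simp only [hT, lt_irrefl, if_false, if_true]
        exact (hcnt' i (r i i) (hrpos i i)).1
      · simp only [hT, if_neg h1, if_neg h2]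
        exact Set.finite_singleton 0
  have hTle : ∀ i j, (((T i j).ncard : ℕ) : ℝ) ≤
      (if i < j then Cij i j else 1) * (if i < j then max 1 (r i j) ^ finrank ℚ L else 1) *
        (if i = j then Ci i * max 1 (r i j) ^ (finrank ℚ L / 2) else 1) := by
    intro i j
    by_cases h1 : i < j
    · rw [if_pos h1, if_pos h1, if_neg (ne_of_lt h1), mul_one]
      simp only [hT, if_pos h1]
      exact (hcnt i j (r i j) (hrpos i j)).2
    · by_cases h2 : i = j
      · subst h2
        rw [if_neg h1, if_neg h1, if_pos rfl, one_mul, one_mul]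
        simp only [hT, lt_irrefl, if_false, if_true]
        exact (hcnt' i (r i i) (hrpos i i)).2
      · rw [if_neg h1, if_neg h1, if_neg h2, mul_one, mul_one]
        simp only [hT, if_neg h1, if_neg h2, Set.ncard_singleton, Nat.cast_one, le_refl]
  set S : Set (Matrix (Fin N) (Fin N) L) := {h | (h.map (cmConjRingHom L))ᵀ = h ∧
    (posRealDiagonal N L a : Matrix (Fin N) (Fin N) (AdeleRing (𝓞 L) L)) * h.map (algebraMap L (AdeleRing (𝓞 L) L)) *
      (posRealDiagonal N L a : Matrix (Fin N) (Fin N) (AdeleRing (𝓞 L) L)) ∈ B} with hS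
  -- the product set of admissible entry functions
  set P : Set (Fin N → Fin N → L) := {k | ∀ i, k i ∈ Set.pi Set.univ (T i)} with hP
  have hPfin : P.Finite := Set.Finite.pi' fun i => Set.Finite.pi fun j => hTfin i j
  have hPcard : P.ncard = ∏ i, ∏ j, (T i j).ncard := by
    have h1 : P = Set.pi Set.univ fun i => Set.pi Set.univ (T i) := by
      ext k; simp [hP]
    have h2 : P.encard = ∏ i, ∏ j, ((T i j).ncard : ℕ∞) := by
      rw [h1, Set.encard_pi_eq_prod_encard]
      refine Finset.prod_congr rfl fun i _ => ?_
      rw [Set.encard_pi_eq_prod_encard]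
      refine Finset.prod_congr rfl fun j _ => ?_
      rw [(hTfin i j).cast_ncard_eq]
    have h3 : (P.ncard : ℕ∞) = ((∏ i, ∏ j, (T i j).ncard : ℕ) : ℕ∞) := by
      rw [hPfin.cast_ncard_eq, h2]
      push_cast
      rfl
    exact_mod_cast h3
  -- `h ↦` its upper-triangular part
  set k : Matrix (Fin N) (Fin N) L → (Fin N → Fin N → L) := fun h i j => if i ≤ j then h i j else 0 with hk
  have hentry : ∀ h ∈ S, ∀ i j, algebraMap L (AdeleRing (𝓞 L) L) (h i j) ∈ realAdele L (r i j) • E i j := by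
    intro h hh i j
    refine Set.mem_smul_set.2 ⟨realAdele L (((a i : ℝ≥0) : ℝ) * ((a j : ℝ≥0) : ℝ)) *
      algebraMap L (AdeleRing (𝓞 L) L) (h i j), ⟨_, hh.2, ?_⟩, ?_⟩
    · change ((posRealDiagonal N L a : Matrix (Fin N) (Fin N) (AdeleRing (𝓞 L) L)) *
          h.map (algebraMap L (AdeleRing (𝓞 L) L)) *
        (posRealDiagonal N L a : Matrix (Fin N) (Fin N) (AdeleRing (𝓞 L) L))) i j = _
      rw [coe_posRealDiagonal_mul_mul_posRealDiagonal_apply, Matrix.map_apply]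
    · rw [smul_eq_mul, ← mul_assoc, ← realAdele_mul, hr]
      simp only [inv_mul_cancel₀ (mul_pos (hapos i) (hapos j)).ne', realAdele_one, one_mul]
  have hmaps : ∀ h ∈ S, k h ∈ P := by
    intro h hh i j _
    change (if i ≤ j then h i j else 0) ∈ T i j
    by_cases h1 : i < j
    · rw [if_pos h1.le]
      simp only [hT, if_pos h1]
      exact hentry h hh i j
    · by_cases h2 : i = j
      · subst h2
        rw [if_pos le_rfl]
        simp only [hT, lt_irrefl, if_false, if_true]
        refine ⟨?_, hentry h hh i i⟩
        have := congrFun (congrFun hh.1 i) i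
        rwa [Matrix.transpose_apply, Matrix.map_apply] at this
      · have h3 : ¬ i ≤ j := fun h' => h'.lt_or_eq.elim h1 h2
        rw [if_neg h3]
        simp only [hT, if_neg h1, if_neg h2]
        exact Set.mem_singleton 0
  have hinj : Set.InjOn k S := by
    intro h hh h' hh' hkk
    ext i j
    rcases le_or_gt i j with hij | hij
    · have := congrFun (congrFun hkk i) j
      simpa only [hk, if_pos hij] using this
    · -- below the diagonal: `h i j = conj (h j i)`
      have e := congrFun (congrFun hkk j) i
      simp only [hk, if_pos hij.le] at e
      have h1 := congrFun (congrFun hh.1 i) j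
      have h2 := congrFun (congrFun hh'.1 i) j
      rw [Matrix.transpose_apply, Matrix.map_apply] at h1 h2
      rw [← h1, ← h2, e]
  have hle : S.ncard ≤ P.ncard := Set.ncard_le_ncard_of_injOn k hmaps hinj hPfin
  have hSfin : S.Finite := Set.Finite.of_finite_image (hPfin.subset (Set.image_subset_iff.2 hmaps)) hinj
  refine ⟨hSfin, ?_⟩
  -- bookkeeping of the bound
  calc ((S.ncard : ℕ) : ℝ) ≤ P.ncard := by exact_mod_cast hle
    _ = ∏ i, ∏ j, (((T i j).ncard : ℕ) : ℝ) := by rw [hPcard]; push_cast; rfl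
    _ ≤ ∏ i, ∏ j, ((if i < j then Cij i j else 1) * (if i < j then max 1 (r i j) ^ finrank ℚ L else 1) *
          (if i = j then Ci i * max 1 (r i j) ^ (finrank ℚ L / 2) else 1)) :=
        Finset.prod_le_prod (fun i _ => Finset.prod_nonneg fun j _ => by positivity)
          fun i _ => Finset.prod_le_prod (fun j _ => by positivity) fun j _ => hTle i j
    _ = (∏ i, ∏ j, (if i < j then Cij i j else (1 : ℝ))) *
          (∏ i, ∏ j, (if i < j then max 1 (r i j) ^ finrank ℚ L else (1 : ℝ))) *
          ∏ i, ∏ j, (if i = j then Ci i * max 1 (r i j) ^ (finrank ℚ L / 2) else (1 : ℝ)) := by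
        simp only [Finset.prod_mul_distrib]
    _ = (∏ i, ∏ j, (if i < j then Cij i j else (1 : ℝ))) *
          (∏ i, ∏ j, (if i < j then max 1 (r i j) ^ finrank ℚ L else (1 : ℝ))) *
          ∏ i, (Ci i * max 1 (r i i) ^ (finrank ℚ L / 2)) := by
        congr 1
        refine Finset.prod_congr rfl fun i _ => ?_
        rw [Finset.prod_ite_eq Finset.univ i, if_pos (Finset.mem_univ i)]
    _ = ((∏ i, ∏ j, if i < j then Cij i j else (1 : ℝ)) * ∏ i, Ci i) *
          ((∏ i, ∏ j, if i < j then max 1 (r i j) ^ finrank ℚ L else (1 : ℝ)) *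
            ∏ i, max 1 (r i i) ^ (finrank ℚ L / 2)) := by
        rw [Finset.prod_mul_distrib]
        ring
    _ = _ := by simp only [hr, sq, mul_assoc]

end Matrices

end Literature.NumberTheory.Automorphic

end
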